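import Literature.MathematicalPhysics.QuantumLattice.HubbardTTPrimeWindowCertificateConvexComb
import Literature.MathematicalPhysics.QuantumLattice.HubbardTTPrimeSourcedCutRows
import HarnessLib

/-!
# Window certificates with CROSS-HAMILTONIAN ANCHOR-CUT slots: point, `D₄`-orbit and cell
# (convex-combination) forms for the `t–t'–U` Hubbard model on `ℤ²`

Family `hubbard` (topic `MathematicalPhysics/QuantumLattice`); written for the certified fast layer of
the Hubbard re-charter (crew hubbard-fast: planner-p1 BOX2-SPEC §5 (iii) "cross-Hamiltonian cuts in cell
mode", items T4w / L-5; referee signing conditions C″-1…6). The window (reduce- or correlator-mode)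
certificates of the many-body bootstrap (Han 2020 §2–3; Wang et al. 2024 §III) carry ONE same-Hamiltonian
energy row `κ (u·1 − Γ E_{Φ(t,t',U)})` whose soundness for torus-limit ground states is the tree theorem
`InfVolFermionState.IsTorusLimitOf.re_sum_expect_d4_ge_of_window_certificate_TT'_ineq`
(`HubbardNNNHoppingTorusLimitCorrelator`). The production certificates of the crew ALSO use certified
LOWER energy bounds issued at OTHER couplings — *anchor cuts* `ℓ_A ≤ e(t, t'_A, U_A, n)` (the cell's
certified rows at `(8, 0, 7/8)`, `(8, −1/4, 7/8)`, …) — as rows `λ_A (Γ E_{Φ(t,t'_A,U_A)} − ℓ_A·1)`,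
`λ_A ≥ 0`: for every translation-invariant state of density `n` the mean `Φ(t,t'_A,U_A)`-energy is at
least `e(t,t'_A,U_A,n)` (the variational principle; in the tree for torus limits of unit
`rectN n`-particle vectors, `IsTorusLimitOf.energyDensityTT'_le_meanEnergy_hubbardTTPrime`,
file `HubbardTTPrimeMeanEnergySupergradient`). So far such a row had NO SLOT in the kernel identity: a
point certificate with cuts was signed by composing two tree theorems, and a CELL bundle with FREE
per-vertex cut multipliers (the crew's mode "(C″)") only on the generic LP basis
`Literature.Computation.Certificates.SharedVaryingBox.le_of_forall_boxVertices_sharedVarying`.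
This module adds the slot, everything PROVED, no definition, no named fact, no numerical input:

* §1 `IsTorusLimitOf.re_sum_expect_d4_ge_of_window_certificate_TT'_ineq_crossCuts` — the `D₄`-reduced
  point theorem with an extra identity term `− Σ_{A} λ_A • (Γ E_{Φ(t,t'_A,U_A)} − ℓ_A • 1)`
  (`λ_A ≥ 0`, `U_A ≥ 0`, `ℓ_A ≤ energyDensityTT' t t'_A U_A n`): SAME conclusion
  `c − Σₖ‖aₖ‖ + (Σ_σ μ_σ)(n/2 − ν) ≤ |S|⁻¹ Σ_{γ∈S} Re ω_{γΛ'}(Γ(d4Emb γ 0) X)` for every torus-limit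
  sector ground state `ω` at the QUERY coupling `(t', U)`. Proof: fold the cut rows into the objective,
  apply the tree theorem, read each rotated copy of an anchor energy observable as the mean anchor energy
  (`IsTorusLimitOf.re_expect_d4Emb_meanEnergyObs`, file `HubbardTTPrimeSourcedCutRows`) and drop the
  nonnegative cut slack `Σ_A λ_A (e_{Φ_A}(ω) − ℓ_A)`. Translation-only corollary
  `IsTorusLimitOf.re_expect_ge_of_window_certificate_TT'_ineq_crossCuts`.
* §2 `IsTorusLimitOf.re_sum_expect_d4_ge_of_window_certificates_convexComb_TT'_ineq_crossCuts` — the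
  CELL form: corner certificates at `(t'ᵢ, Uᵢ)` sharing `X, κ, ν, O, B`, the symmetry data and the word
  lists (the rows whose operators depend on the couplings, exactly as in
  `…window_certificates_convexComb_TT'_ineq`, file `HubbardTTPrimeWindowCertificateConvexComb`) and
  carrying cut rows on a COMMON anchor list with FREE per-vertex multipliers `λᵢ_A ≥ 0` — a cut row does
  not mention the cell parameter, so it averages like the density row — combine under convex weights
  into a §1-certificate at the barycentre with multipliers `Σᵢ wᵢ λᵢ_A`.
* §3 the box evaluator's calling conventions (translation-only, prescribed target `(t', U')` with the
  barycentre identities as hypotheses): `…_convexComb_TT'_ineq_crossCuts_weighted_at` (weighted corner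
  bounds, caps `uᵢ` the corner values of an affine majorant: `e(t,t',U',n) ≤ Σ wᵢuᵢ`) and
  `…_crossCuts_weighted_at_rebook` (arbitrary per-vertex cap values, cap slack `κ(Σ wᵢuᵢ − ū)` charged
  at the query point, `e(t,t',U',n) ≤ ū`).

What is deliberately NOT here: cells with an extent in the density `n` (an anchor cut is a same-`n`
object: `ℓ_A ≤ e(t,t'_A,U_A,n)` at the booking density only); rows of the SOURCED Hamiltonians
(`HubbardTTPrimeSourcedCutRows` §2–§3); per-corner `κᵢ, Bᵢ` (the covariance-remainder form,
`BoxDualCovarianceCombination`). HONEST FRAMING: certificate bookkeeping — which identities certify what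
for which states; nothing here bears on superconductivity.

## Mathlib / tree search

REUSED: `IsTorusLimitOf.re_sum_expect_d4_ge_of_window_certificate_TT'_ineq`,
`InfVolFermionState.expect_fermionEmbed_d4Emb_one_zero` (`HubbardNNNHoppingTorusLimitCorrelator`);
`IsTorusLimitOf.re_expect_d4Emb_meanEnergyObs` (`HubbardTTPrimeSourcedCutRows`);
`IsTorusLimitOf.energyDensityTT'_le_meanEnergy_hubbardTTPrime` (`HubbardTTPrimeMeanEnergySupergradient`);
`hubbardTTPrimeFermionInteraction_convexComb`, `FermionInteraction.localHamiltonian_of_sum`,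
`FermionInteraction.meanEnergyObs_of_sum`, `gramForm_sum_smul` (`HubbardTTPrimeWindowCertificateConvexComb`,
whose §2 averaging argument §2 below repeats verbatim with one more θ-constant row); `mem_szSector_iff`;
`InfVolFermionState.expect_one/compatible`. `lean search 'crossCut|anchorCut|Cuts_' --decl`: only the
named-moment LP rows `capCuts_dual_le[_of_groundState]`, `docc_mem_Icc_chord_of_cap_of_cuts`
(`HubbardTTPrimeCapCutDualRows`) and the sourced-cut brackets of `HubbardTTPrimeSourcedCutRows` §4 — no
window IDENTITY with cut slots.

## References

* J. Wang et al., *Certifying ground-state properties of many-body systems*, PRX 14 (2024) 031006,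
  §III (observable bounds under energy constraints: "⟨ψ|E↑ − H|ψ⟩ ≥ 0 and ⟨ψ|H − E↓|ψ⟩ ≥ 0 … can be
  added as additional constraints"). [cite: WangEtAl2024, §III]
* X. Han, *Quantum many-body bootstrap*, arXiv:2006.06002 (2020), §3. [cite: Han2020Bootstrap, §3]
* D. Ruelle, *Statistical Mechanics: Rigorous Results* (1969), §3.4 (variational principle for the
  ground-state energy density). [cite: Ruelle1969, §3.4]
* D. P. Bertsekas, *Nonlinear Programming*, 2nd ed. (1999), Prop. 5.1.3 (weak duality, pointwise
  form). [cite: Bertsekas1999NonlinearProgramming, Prop. 5.1.3]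
-/

noncomputable section

namespace Literature.MathematicalPhysics.QuantumLattice

open Matrix Finset HubbardWave0 Literature.Probability.LatticeModels ThermodynamicLimit
open Literature.MathematicalPhysics.QuantumManyBody.StateRelaxation
open _root_.Filter
open scoped _root_.Topology ComplexOrder BigOperators

namespace InfVolFermionState

/-! ### §1 Point certificates with anchor-cut slots -/

/-- Reading a folded objective: for any state `ω`, any `γ ∈ D₄`, any `X, Eₖ ∈ 𝔄_{Λ'}` and reals
`λₖ, ℓₖ`: `Re ω_{γΛ'}(Γ_γ (X − Σₖ λₖ•(Eₖ − ℓₖ•1))) = Re ω_{γΛ'}(Γ_γ X) − Σₖ λₖ (Re ω_{γΛ'}(Γ_γ Eₖ) − ℓₖ)`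
(linearity of `Γ_γ` and `ω_{γΛ'}`, `ω_{γΛ'}(1) = 1`). [folklore] -/
private theorem re_expect_d4Emb_sub_sum_smul (ω : InfVolFermionState 2) (g : DihedralGroup 4)
    {Λ' : Finset (Site 2)} (Xw : FermionOp Λ') {α : Type*} (A : Finset α) (lam lo : α → ℝ)
    (E : α → FermionOp Λ') :
    (ω.expect (d4ShiftSet g 0 Λ') (fermionEmbed (PolySite.d4Emb g 0 Λ')
        (Xw - ∑ k ∈ A, ((lam k : ℝ) : ℂ) • (E k - ((lo k : ℝ) : ℂ) • (1 : FermionOp Λ'))))).re =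
      (ω.expect (d4ShiftSet g 0 Λ') (fermionEmbed (PolySite.d4Emb g 0 Λ') Xw)).re -
        ∑ k ∈ A, lam k *
          ((ω.expect (d4ShiftSet g 0 Λ') (fermionEmbed (PolySite.d4Emb g 0 Λ') (E k))).re - lo k) := by
  simp only [map_sub, map_sum, map_smul, map_one, ω.expect_one, smul_eq_mul, mul_one, Complex.sub_re,
    Complex.re_sum, Complex.re_ofReal_mul, Complex.ofReal_re]

/-- **Window certificate with an energy cap AND cross-Hamiltonian anchor cuts ⇒ orbit-mean correlator
bound for every torus-limit ground state of the `t–t'` Hubbard model on `ℤ²`, at every filling.**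
Data exactly as in `IsTorusLimitOf.re_sum_expect_d4_ge_of_window_certificate_TT'_ineq` (objective
`X ∈ 𝔄_{Λ'}`, density multipliers `μ_σ`, `ν`, energy cap `(κ ≥ 0, u)` with
`energyDensityTT' t t' U n ≤ u`, Han's constraint families, point-group labels `γₗ ∈ S` for a finite
`S ∋ 1` closed under multiplication) PLUS a finite list of ANCHOR CUTS: couplings `(t'_A, U_A)`,
`U_A ≥ 0`, certified lower bounds `ℓ_A ≤ energyDensityTT' t t'_A U_A n` and multipliers `λ_A ≥ 0`,
entering the window identity as `− Σ_A λ_A • (Γ E_{Φ(t,t'_A,U_A)} − ℓ_A • 1)`. Then for every torus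
limit `ω` of unit ground states `ψ_L` of the sectors `(rectN n L, S^z = 0)` of
`hubbardTorusTT' L t t' U` along `Ls → ∞`:
`c − Σₖ ‖aₖ‖ + (Σ_σ μ_σ)(n/2 − ν) ≤ |S|⁻¹ Σ_{γ∈S} Re ω_{γΛ'}(Γ(d4Emb γ 0) X)`.
(Fold the cuts into the objective `X' = X − Σ_A λ_A(Γ E_A − ℓ_A·1)`, apply the cut-free theorem, and on
each rotated copy `Re ω_{γΛ'}(Γ_γ Γ E_A) = e_{Φ_A}(ω) ≥ e(t,t'_A,U_A,n) ≥ ℓ_A` by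
`re_expect_d4Emb_meanEnergyObs` and the variational inequality.) Wang et al. 2024 §III eq. (obsopt)
(energy half-spaces as additional constraints); Ruelle 1969 §3.4. [cite: WangEtAl2024, §III] -/
theorem IsTorusLimitOf.re_sum_expect_d4_ge_of_window_certificate_TT'_ineq_crossCuts
    (t t' : ℝ) {U : ℝ} (hU : 0 ≤ U) {n : ℝ} (hn0 : 0 ≤ n) (hn2 : n < 2) {κ u : ℝ} (hκ : 0 ≤ κ)
    (hu : ThermodynamicLimit.energyDensityTT' t t' U n ≤ u)
    {α : Type*} (A : Finset α) (tpc Uc lo lam : α → ℝ) (hUc : ∀ k ∈ A, 0 ≤ Uc k)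
    (hlo : ∀ k ∈ A, lo k ≤ ThermodynamicLimit.energyDensityTT' t (tpc k) (Uc k) n)
    (hlam : ∀ k ∈ A, 0 ≤ lam k)
    {Λ Λ' : Finset (Site 2)} (hΛ : Λ ⊆ Λ') (h8 : thicken Λ 1 ⊆ Λ')
    (h0 : thicken ({0} : Finset (Site 2)) 1 ⊆ Λ') (hz : (0 : Site 2) ∈ Λ')
    {S : Finset (DihedralGroup 4)} (h1 : (1 : DihedralGroup 4) ∈ S) (hmul : ∀ a ∈ S, ∀ b ∈ S, a * b ∈ S)
    (Xw : FermionOp Λ') (μ : Fin 2 → ℝ) (ν : ℝ)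
    {m : Type*} [Fintype m] [DecidableEq m] {Λm : Matrix m m ℂ} (hΛm : Λm.PosSemidef)
    (O : m → FermionOp Λ')
    {κ' : Type*} (s : Finset κ') (B : κ' → FermionOp Λ)
    {ι : Type*} (tt : Finset ι) (γ : ι → DihedralGroup 4) (hγS : ∀ l ∈ tt, γ l ∈ S) (wv : ι → Site 2)
    (hsh : ∀ l, d4ShiftSet (γ l) (wv l) Λ ⊆ Λ') (Y : ι → FermionOp Λ)
    {ρ : Type*} (uu : Finset ρ) (b : ρ → ℂ) (cw : ρ → List (Orb (PolySite Λ') × Bool))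
    (hcw : ∀ j ∈ uu, ladderCharge (cw j) ≠ 0 ∨ ladderSpinCharge (cw j) ≠ 0)
    {δ : Type*} (ah : Finset δ) (dc : δ → ℝ) (V : δ → FermionOp Λ')
    {κ'' : Type*} (w : Finset κ'') (a : κ'' → ℂ) (word : κ'' → List (Orb (PolySite Λ') × Bool)) {c : ℝ}
    (hcert : Xw - (c : ℂ) • (1 : FermionOp Λ') -
        ∑ σ : Fin 2, ((μ σ : ℝ) : ℂ) • (nAt 0 hz σ - ((ν : ℝ) : ℂ) • (1 : FermionOp Λ')) -
        ((κ : ℝ) : ℂ) • (((u : ℝ) : ℂ) • (1 : FermionOp Λ') -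
          fermionEmbed (PolySite.incl h0) ((hubbardTTPrimeFermionInteraction t t' U).meanEnergyObs 1)) -
        ∑ k ∈ A, ((lam k : ℝ) : ℂ) •
          (fermionEmbed (PolySite.incl h0)
              ((hubbardTTPrimeFermionInteraction t (tpc k) (Uc k)).meanEnergyObs 1) -
            ((lo k : ℝ) : ℂ) • (1 : FermionOp Λ')) =
      gramForm Λm O +
        (∑ k ∈ s, ((hubbardTTPrimeFermionInteraction t t' U).localHamiltonian Λ' * fermionEmbed (PolySite.incl hΛ) (B k) -
            fermionEmbed (PolySite.incl hΛ) (B k) * (hubbardTTPrimeFermionInteraction t t' U).localHamiltonian Λ') +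
          ∑ l ∈ tt, (fermionEmbed (PolySite.incl (hsh l)) (fermionEmbed (PolySite.d4Emb (γ l) (wv l) Λ) (Y l)) -
            fermionEmbed (PolySite.incl hΛ) (Y l)) +
          ∑ j ∈ uu, b j • ladderWord (cw j)) +
        (∑ m' ∈ ah, ((dc m' : ℝ) : ℂ) • ((V m')ᴴ - V m') + ∑ k ∈ w, a k • ladderWord (word k)))
    {Ls : ℕ → ℕ} (hLs : Tendsto Ls atTop atTop)
    {ψ : ∀ L, Fock (Orb (FermionTorus 2 L))}
    (hψ : ∀ j, IsGroundStateInSector (hubbardTorusTT' (Ls j) t t' U)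
      (ThermodynamicLimit.rectN n (Ls j)) 0 (ψ (Ls j)))
    (hψ1 : ∀ j, star (ψ (Ls j)) ⬝ᵥ ψ (Ls j) = 1)
    {ω : InfVolFermionState 2} (hω : ω.IsTorusLimitOf ψ Ls) :
    c - ∑ k ∈ w, ‖a k‖ + (∑ σ : Fin 2, μ σ) * (n / 2 - ν) ≤
      (S.card : ℝ)⁻¹ * ∑ g ∈ S,
        (ω.expect (d4ShiftSet g 0 Λ') (fermionEmbed (PolySite.d4Emb g 0 Λ') Xw)).re := by
  -- the folded objective
  set X' : FermionOp Λ' := Xw - ∑ k ∈ A, ((lam k : ℝ) : ℂ) •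
    (fermionEmbed (PolySite.incl h0) ((hubbardTTPrimeFermionInteraction t (tpc k) (Uc k)).meanEnergyObs 1) -
      ((lo k : ℝ) : ℂ) • (1 : FermionOp Λ')) with hX'
  -- the same identity, cut rows inside the objective
  have hcert' : X' - (c : ℂ) • (1 : FermionOp Λ') -
      ∑ σ : Fin 2, ((μ σ : ℝ) : ℂ) • (nAt 0 hz σ - ((ν : ℝ) : ℂ) • (1 : FermionOp Λ')) -
      ((κ : ℝ) : ℂ) • (((u : ℝ) : ℂ) • (1 : FermionOp Λ') -
        fermionEmbed (PolySite.incl h0) ((hubbardTTPrimeFermionInteraction t t' U).meanEnergyObs 1)) =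
      gramForm Λm O +
        (∑ k ∈ s, ((hubbardTTPrimeFermionInteraction t t' U).localHamiltonian Λ' * fermionEmbed (PolySite.incl hΛ) (B k) -
            fermionEmbed (PolySite.incl hΛ) (B k) * (hubbardTTPrimeFermionInteraction t t' U).localHamiltonian Λ') +
          ∑ l ∈ tt, (fermionEmbed (PolySite.incl (hsh l)) (fermionEmbed (PolySite.d4Emb (γ l) (wv l) Λ) (Y l)) -
            fermionEmbed (PolySite.incl hΛ) (Y l)) +
          ∑ j ∈ uu, b j • ladderWord (cw j)) +
        (∑ m' ∈ ah, ((dc m' : ℝ) : ℂ) • ((V m')ᴴ - V m') + ∑ k ∈ w, a k • ladderWord (word k)) := by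
    rw [← hcert, hX']
    abel
  have h := hω.re_sum_expect_d4_ge_of_window_certificate_TT'_ineq t t' hU hn0 hn2 hκ hu hΛ h8 h0 hz h1
    hmul X' μ ν hΛm O s B tt γ hγS wv hsh Y uu b cw hcw ah dc V w a word hcert' hLs hψ hψ1
  -- the cut slack of the query state is nonnegative: `ℓ_A ≤ e(t,t'_A,U_A,n) ≤ e_{Φ_A}(ω)`
  have hN : ∀ j, IsNParticle (ThermodynamicLimit.rectN n (Ls j)) (ψ (Ls j)) := fun j =>
    ((mem_szSector_iff _ _ _).1 (hψ j).1).1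
  have hcut : ∀ k ∈ A, lo k ≤ ω.meanEnergy (hubbardTTPrimeFermionInteraction t (tpc k) (Uc k)) 1 :=
    fun k hk => (hlo k hk).trans
      (hω.energyDensityTT'_le_meanEnergy_hubbardTTPrime t (tpc k) (hUc k hk) hn0 hn2 hLs hN hψ1)
  have hnn : 0 ≤ ∑ k ∈ A, lam k *
      (ω.meanEnergy (hubbardTTPrimeFermionInteraction t (tpc k) (Uc k)) 1 - lo k) :=
    Finset.sum_nonneg fun k hk => mul_nonneg (hlam k hk) (sub_nonneg.2 (hcut k hk))
  -- read each rotated copy of the folded objective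
  have hterm : ∀ g ∈ S, (ω.expect (d4ShiftSet g 0 Λ') (fermionEmbed (PolySite.d4Emb g 0 Λ') X')).re =
      (ω.expect (d4ShiftSet g 0 Λ') (fermionEmbed (PolySite.d4Emb g 0 Λ') Xw)).re -
        ∑ k ∈ A, lam k *
          (ω.meanEnergy (hubbardTTPrimeFermionInteraction t (tpc k) (Uc k)) 1 - lo k) := by
    intro g _
    rw [hX', re_expect_d4Emb_sub_sum_smul]
    congr 1
    refine Finset.sum_congr rfl fun k _ => ?_
    rw [hω.re_expect_d4Emb_meanEnergyObs t (tpc k) (Uc k) g h0 hLs]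
  have hcard : (S.card : ℝ) ≠ 0 := by exact_mod_cast (Finset.card_pos.2 ⟨1, h1⟩).ne'
  rw [Finset.sum_congr rfl hterm, Finset.sum_sub_distrib, Finset.sum_const, nsmul_eq_mul] at h
  set C := ∑ k ∈ A, lam k * (ω.meanEnergy (hubbardTTPrimeFermionInteraction t (tpc k) (Uc k)) 1 - lo k)
    with hC
  set T := ∑ g ∈ S, (ω.expect (d4ShiftSet g 0 Λ') (fermionEmbed (PolySite.d4Emb g 0 Λ') Xw)).re with hT
  have hsplit : (S.card : ℝ)⁻¹ * (T - (S.card : ℝ) * C) = (S.card : ℝ)⁻¹ * T - C := by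
    rw [mul_sub, ← mul_assoc, inv_mul_cancel₀ hcard, one_mul]
  rw [hsplit] at h
  linarith

/-- **Translation-only certificates with anchor cuts ⇒ the correlator of every torus-limit ground
state.** Under the hypotheses of `…_TT'_ineq_crossCuts` with all point-group labels trivial (`γₗ = 1`):
`c − Σₖ ‖aₖ‖ + (Σ_σ μ_σ)(n/2 − ν) ≤ Re ω_{Λ'}(X)`. [cite: WangEtAl2024, §III] -/
theorem IsTorusLimitOf.re_expect_ge_of_window_certificate_TT'_ineq_crossCuts
    (t t' : ℝ) {U : ℝ} (hU : 0 ≤ U) {n : ℝ} (hn0 : 0 ≤ n) (hn2 : n < 2) {κ u : ℝ} (hκ : 0 ≤ κ)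
    (hu : ThermodynamicLimit.energyDensityTT' t t' U n ≤ u)
    {α : Type*} (A : Finset α) (tpc Uc lo lam : α → ℝ) (hUc : ∀ k ∈ A, 0 ≤ Uc k)
    (hlo : ∀ k ∈ A, lo k ≤ ThermodynamicLimit.energyDensityTT' t (tpc k) (Uc k) n)
    (hlam : ∀ k ∈ A, 0 ≤ lam k)
    {Λ Λ' : Finset (Site 2)} (hΛ : Λ ⊆ Λ') (h8 : thicken Λ 1 ⊆ Λ')
    (h0 : thicken ({0} : Finset (Site 2)) 1 ⊆ Λ') (hz : (0 : Site 2) ∈ Λ')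
    (Xw : FermionOp Λ') (μ : Fin 2 → ℝ) (ν : ℝ)
    {m : Type*} [Fintype m] [DecidableEq m] {Λm : Matrix m m ℂ} (hΛm : Λm.PosSemidef)
    (O : m → FermionOp Λ')
    {κ' : Type*} (s : Finset κ') (B : κ' → FermionOp Λ)
    {ι : Type*} (tt : Finset ι) (γ : ι → DihedralGroup 4) (hγ1 : ∀ l ∈ tt, γ l = 1) (wv : ι → Site 2)
    (hsh : ∀ l, d4ShiftSet (γ l) (wv l) Λ ⊆ Λ') (Y : ι → FermionOp Λ)
    {ρ : Type*} (uu : Finset ρ) (b : ρ → ℂ) (cw : ρ → List (Orb (PolySite Λ') × Bool))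
    (hcw : ∀ j ∈ uu, ladderCharge (cw j) ≠ 0 ∨ ladderSpinCharge (cw j) ≠ 0)
    {δ : Type*} (ah : Finset δ) (dc : δ → ℝ) (V : δ → FermionOp Λ')
    {κ'' : Type*} (w : Finset κ'') (a : κ'' → ℂ) (word : κ'' → List (Orb (PolySite Λ') × Bool)) {c : ℝ}
    (hcert : Xw - (c : ℂ) • (1 : FermionOp Λ') -
        ∑ σ : Fin 2, ((μ σ : ℝ) : ℂ) • (nAt 0 hz σ - ((ν : ℝ) : ℂ) • (1 : FermionOp Λ')) -
        ((κ : ℝ) : ℂ) • (((u : ℝ) : ℂ) • (1 : FermionOp Λ') -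
          fermionEmbed (PolySite.incl h0) ((hubbardTTPrimeFermionInteraction t t' U).meanEnergyObs 1)) -
        ∑ k ∈ A, ((lam k : ℝ) : ℂ) •
          (fermionEmbed (PolySite.incl h0)
              ((hubbardTTPrimeFermionInteraction t (tpc k) (Uc k)).meanEnergyObs 1) -
            ((lo k : ℝ) : ℂ) • (1 : FermionOp Λ')) =
      gramForm Λm O +
        (∑ k ∈ s, ((hubbardTTPrimeFermionInteraction t t' U).localHamiltonian Λ' * fermionEmbed (PolySite.incl hΛ) (B k) -
            fermionEmbed (PolySite.incl hΛ) (B k) * (hubbardTTPrimeFermionInteraction t t' U).localHamiltonian Λ') +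
          ∑ l ∈ tt, (fermionEmbed (PolySite.incl (hsh l)) (fermionEmbed (PolySite.d4Emb (γ l) (wv l) Λ) (Y l)) -
            fermionEmbed (PolySite.incl hΛ) (Y l)) +
          ∑ j ∈ uu, b j • ladderWord (cw j)) +
        (∑ m' ∈ ah, ((dc m' : ℝ) : ℂ) • ((V m')ᴴ - V m') + ∑ k ∈ w, a k • ladderWord (word k)))
    {Ls : ℕ → ℕ} (hLs : Tendsto Ls atTop atTop)
    {ψ : ∀ L, Fock (Orb (FermionTorus 2 L))}
    (hψ : ∀ j, IsGroundStateInSector (hubbardTorusTT' (Ls j) t t' U)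
      (ThermodynamicLimit.rectN n (Ls j)) 0 (ψ (Ls j)))
    (hψ1 : ∀ j, star (ψ (Ls j)) ⬝ᵥ ψ (Ls j) = 1)
    {ω : InfVolFermionState 2} (hω : ω.IsTorusLimitOf ψ Ls) :
    c - ∑ k ∈ w, ‖a k‖ + (∑ σ : Fin 2, μ σ) * (n / 2 - ν) ≤ (ω.expect Λ' Xw).re := by
  have h1 : (1 : DihedralGroup 4) ∈ ({1} : Finset (DihedralGroup 4)) := Finset.mem_singleton_self 1
  have hmul : ∀ a ∈ ({1} : Finset (DihedralGroup 4)), ∀ b ∈ ({1} : Finset (DihedralGroup 4)),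
      a * b ∈ ({1} : Finset (DihedralGroup 4)) := by
    intro a ha b hb
    rw [Finset.mem_singleton] at ha hb ⊢
    rw [ha, hb, mul_one]
  have hγS : ∀ l ∈ tt, γ l ∈ ({1} : Finset (DihedralGroup 4)) := fun l hl =>
    Finset.mem_singleton.2 (hγ1 l hl)
  have h := hω.re_sum_expect_d4_ge_of_window_certificate_TT'_ineq_crossCuts t t' hU hn0 hn2 hκ hu A
    tpc Uc lo lam hUc hlo hlam hΛ h8 h0 hz h1 hmul Xw μ ν hΛm O s B tt γ hγS wv hsh Y uu b cw hcw ah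
    dc V w a word hcert hLs hψ hψ1
  rwa [Finset.sum_singleton, Finset.card_singleton, Nat.cast_one, inv_one, one_mul,
    ω.expect_fermionEmbed_d4Emb_one_zero] at h

/-! ### §2 Cells: the convex combination of corner certificates with free per-vertex cut multipliers -/

/-- **Box certificate with anchor cuts (point-group-reduced form).** Corner certificates at
`(t'ᵢ, Uᵢ)`, `i ∈ I`, sharing `X`, `κ`, `ν`, the Gram basis `O`, the eom family `B`, the symmetry
data `(γ, wv)`, the word lists AND the anchor list `(t'_A, U_A, ℓ_A)_{A}` (`U_A ≥ 0`,
`ℓ_A ≤ e(t,t'_A,U_A,n)`), with free `cᵢ, uᵢ, μᵢ, Λmᵢ ⪰ 0, Yᵢ, bᵢ, dcᵢ, aᵢ` and FREE per-vertex cut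
multipliers `λᵢ_A ≥ 0`, and convex weights `wᵢ ≥ 0`, `Σ wᵢ = 1`: for every torus-limit ground state
`ω` at the barycentre `(Σ wᵢ t'ᵢ, Σ wᵢ Uᵢ)` and the single energy hypothesis
`e(t, Σ w t', Σ w U, n) ≤ Σ wᵢ uᵢ`,
`Σ wᵢ cᵢ − Σₖ ‖Σᵢ wᵢ aᵢₖ‖ + (Σ_σ Σᵢ wᵢ μᵢσ)(n/2 − ν) ≤ |S|⁻¹ Σ_{γ∈S} Re ω_{γΛ'}(Γ(d4Emb γ 0) X)`.
(The cut row `λᵢ_A (Γ E_{Φ(t,t'_A,U_A)} − ℓ_A·1)` does not mention `(t'ᵢ, Uᵢ)`, so the weighted sum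
of the corner identities is a §1-identity at the barycentre with cut multipliers `Σᵢ wᵢ λᵢ_A`; the
rest of the averaging is `…window_certificates_convexComb_TT'_ineq` verbatim.) This is the crew's
cell bundle "(C″)" (cap and eom multipliers shared, cut multipliers free per vertex) BY NAME.
[cite: WangEtAl2024, §III] [cite: Bertsekas1999NonlinearProgramming, Prop. 5.1.3] -/
theorem IsTorusLimitOf.re_sum_expect_d4_ge_of_window_certificates_convexComb_TT'_ineq_crossCuts
    (t : ℝ) {ι₀ : Type*} (I : Finset ι₀) (w : ι₀ → ℝ) (hw0 : ∀ i ∈ I, 0 ≤ w i)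
    (hw1 : ∑ i ∈ I, w i = 1) (tp U u c : ι₀ → ℝ) (hU : ∀ i ∈ I, 0 ≤ U i)
    {n : ℝ} (hn0 : 0 ≤ n) (hn2 : n < 2) {κ : ℝ} (hκ : 0 ≤ κ)
    (hu : ThermodynamicLimit.energyDensityTT' t (∑ i ∈ I, w i * tp i) (∑ i ∈ I, w i * U i) n ≤
      ∑ i ∈ I, w i * u i)
    {α : Type*} (A : Finset α) (tpc Uc lo : α → ℝ) (lam : ι₀ → α → ℝ) (hUc : ∀ k ∈ A, 0 ≤ Uc k)
    (hlo : ∀ k ∈ A, lo k ≤ ThermodynamicLimit.energyDensityTT' t (tpc k) (Uc k) n)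
    (hlam : ∀ i ∈ I, ∀ k ∈ A, 0 ≤ lam i k)
    {Λ Λ' : Finset (Site 2)} (hΛ : Λ ⊆ Λ') (h8 : thicken Λ 1 ⊆ Λ')
    (h0 : thicken ({0} : Finset (Site 2)) 1 ⊆ Λ') (hz : (0 : Site 2) ∈ Λ')
    {S : Finset (DihedralGroup 4)} (h1 : (1 : DihedralGroup 4) ∈ S) (hmul : ∀ a ∈ S, ∀ b ∈ S, a * b ∈ S)
    (Xw : FermionOp Λ') (μ : ι₀ → Fin 2 → ℝ) (ν : ℝ)
    {m : Type*} [Fintype m] [DecidableEq m] (Λm : ι₀ → Matrix m m ℂ)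
    (hΛm : ∀ i ∈ I, (Λm i).PosSemidef) (O : m → FermionOp Λ')
    {κ' : Type*} (s : Finset κ') (B : κ' → FermionOp Λ)
    {ι : Type*} (tt : Finset ι) (γ : ι → DihedralGroup 4) (hγS : ∀ l ∈ tt, γ l ∈ S) (wv : ι → Site 2)
    (hsh : ∀ l, d4ShiftSet (γ l) (wv l) Λ ⊆ Λ') (Y : ι₀ → ι → FermionOp Λ)
    {ρ : Type*} (uu : Finset ρ) (b : ι₀ → ρ → ℂ) (cw : ρ → List (Orb (PolySite Λ') × Bool))
    (hcw : ∀ j ∈ uu, ladderCharge (cw j) ≠ 0 ∨ ladderSpinCharge (cw j) ≠ 0)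
    {δ : Type*} (ah : Finset δ) (dc : ι₀ → δ → ℝ) (V : δ → FermionOp Λ')
    {κ'' : Type*} (wd : Finset κ'') (a : ι₀ → κ'' → ℂ)
    (word : κ'' → List (Orb (PolySite Λ') × Bool))
    (hcert : ∀ i ∈ I, Xw - ((c i : ℝ) : ℂ) • (1 : FermionOp Λ') -
        ∑ σ : Fin 2, ((μ i σ : ℝ) : ℂ) • (nAt 0 hz σ - ((ν : ℝ) : ℂ) • (1 : FermionOp Λ')) -
        ((κ : ℝ) : ℂ) • (((u i : ℝ) : ℂ) • (1 : FermionOp Λ') -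
          fermionEmbed (PolySite.incl h0)
            ((hubbardTTPrimeFermionInteraction t (tp i) (U i)).meanEnergyObs 1)) -
        ∑ k ∈ A, ((lam i k : ℝ) : ℂ) •
          (fermionEmbed (PolySite.incl h0)
              ((hubbardTTPrimeFermionInteraction t (tpc k) (Uc k)).meanEnergyObs 1) -
            ((lo k : ℝ) : ℂ) • (1 : FermionOp Λ')) =
      gramForm (Λm i) O +
        (∑ k ∈ s, ((hubbardTTPrimeFermionInteraction t (tp i) (U i)).localHamiltonian Λ' *
              fermionEmbed (PolySite.incl hΛ) (B k) -
            fermionEmbed (PolySite.incl hΛ) (B k) *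
              (hubbardTTPrimeFermionInteraction t (tp i) (U i)).localHamiltonian Λ') +
          ∑ l ∈ tt, (fermionEmbed (PolySite.incl (hsh l))
              (fermionEmbed (PolySite.d4Emb (γ l) (wv l) Λ) (Y i l)) -
            fermionEmbed (PolySite.incl hΛ) (Y i l)) +
          ∑ j ∈ uu, b i j • ladderWord (cw j)) +
        (∑ m' ∈ ah, ((dc i m' : ℝ) : ℂ) • ((V m')ᴴ - V m') + ∑ k ∈ wd, a i k • ladderWord (word k)))
    {Ls : ℕ → ℕ} (hLs : Tendsto Ls atTop atTop)
    {ψ : ∀ L, Fock (Orb (FermionTorus 2 L))}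
    (hψ : ∀ j, IsGroundStateInSector
      (hubbardTorusTT' (Ls j) t (∑ i ∈ I, w i * tp i) (∑ i ∈ I, w i * U i))
      (ThermodynamicLimit.rectN n (Ls j)) 0 (ψ (Ls j)))
    (hψ1 : ∀ j, star (ψ (Ls j)) ⬝ᵥ ψ (Ls j) = 1)
    {ω : InfVolFermionState 2} (hω : ω.IsTorusLimitOf ψ Ls) :
    ∑ i ∈ I, w i * c i - ∑ k ∈ wd, ‖∑ i ∈ I, ((w i : ℝ) : ℂ) * a i k‖ +
        (∑ σ : Fin 2, ∑ i ∈ I, w i * μ i σ) * (n / 2 - ν) ≤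
      (S.card : ℝ)⁻¹ * ∑ g ∈ S,
        (ω.expect (d4ShiftSet g 0 Λ') (fermionEmbed (PolySite.d4Emb g 0 Λ') Xw)).re := by
  -- the interaction at the barycentre is the weighted sum of the corner interactions
  have hUbar : 0 ≤ ∑ i ∈ I, w i * U i :=
    Finset.sum_nonneg fun i hi => mul_nonneg (hw0 i hi) (hU i hi)
  have hΦ : ∀ X, (hubbardTTPrimeFermionInteraction t (∑ i ∈ I, w i * tp i) (∑ i ∈ I, w i * U i)).Φ X =
      ∑ i ∈ I, ((w i : ℝ) : ℂ) • (hubbardTTPrimeFermionInteraction t (tp i) (U i)).Φ X := fun X =>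
    hubbardTTPrimeFermionInteraction_convexComb I w hw1 t tp U X
  have hH := FermionInteraction.localHamiltonian_of_sum hΦ Λ'
  have hE := FermionInteraction.meanEnergyObs_of_sum hΦ 1
  -- shorthand for the corner and barycentre objects
  set Φb := hubbardTTPrimeFermionInteraction t (∑ i ∈ I, w i * tp i) (∑ i ∈ I, w i * U i) with hΦb
  set Hi : ι₀ → FermionOp Λ' := fun i =>
    (hubbardTTPrimeFermionInteraction t (tp i) (U i)).localHamiltonian Λ' with hHi
  set Ei : ι₀ → FermionOp (thicken ({0} : Finset (Site 2)) 1) := fun i =>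
    (hubbardTTPrimeFermionInteraction t (tp i) (U i)).meanEnergyObs 1 with hEi
  set Ck : α → FermionOp Λ' := fun k =>
    fermionEmbed (PolySite.incl h0) ((hubbardTTPrimeFermionInteraction t (tpc k) (Uc k)).meanEnergyObs 1) -
      ((lo k : ℝ) : ℂ) • (1 : FermionOp Λ') with hCk
  have hH' : Φb.localHamiltonian Λ' = ∑ i ∈ I, ((w i : ℝ) : ℂ) • Hi i := hH
  have hE' : Φb.meanEnergyObs 1 = ∑ i ∈ I, ((w i : ℝ) : ℂ) • Ei i := hE
  -- averaged data
  have hΛbar : (∑ i ∈ I, ((w i : ℝ) : ℂ) • Λm i).PosSemidef :=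
    Matrix.posSemidef_sum I fun i hi => (hΛm i hi).smul (Complex.zero_le_real.2 (hw0 i hi))
  have hw1C : ∑ i ∈ I, ((w i : ℝ) : ℂ) = 1 := by
    rw [← Complex.ofReal_sum, hw1, Complex.ofReal_one]
  -- §A the left-hand sides combine
  have hl : ∑ i ∈ I, ((w i : ℝ) : ℂ) • (Xw - ((c i : ℝ) : ℂ) • (1 : FermionOp Λ') -
        ∑ σ : Fin 2, ((μ i σ : ℝ) : ℂ) • (nAt 0 hz σ - ((ν : ℝ) : ℂ) • (1 : FermionOp Λ')) -
        ((κ : ℝ) : ℂ) • (((u i : ℝ) : ℂ) • (1 : FermionOp Λ') - fermionEmbed (PolySite.incl h0) (Ei i)) -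
        ∑ k ∈ A, ((lam i k : ℝ) : ℂ) • Ck k) =
      Xw - (((∑ i ∈ I, w i * c i : ℝ)) : ℂ) • (1 : FermionOp Λ') -
        ∑ σ : Fin 2, (((∑ i ∈ I, w i * μ i σ : ℝ)) : ℂ) • (nAt 0 hz σ - ((ν : ℝ) : ℂ) • (1 : FermionOp Λ')) -
        ((κ : ℝ) : ℂ) • ((((∑ i ∈ I, w i * u i : ℝ)) : ℂ) • (1 : FermionOp Λ') -
          fermionEmbed (PolySite.incl h0) (Φb.meanEnergyObs 1)) -
        ∑ k ∈ A, (((∑ i ∈ I, w i * lam i k : ℝ)) : ℂ) • Ck k := by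
    have P1 : ∑ i ∈ I, ((w i : ℝ) : ℂ) • Xw = Xw := by
      rw [← Finset.sum_smul, hw1C, one_smul]
    have P2 : ∑ i ∈ I, ((w i : ℝ) : ℂ) • (((c i : ℝ) : ℂ) • (1 : FermionOp Λ')) =
        (((∑ i ∈ I, w i * c i : ℝ)) : ℂ) • (1 : FermionOp Λ') := by
      simp_rw [smul_smul]
      rw [← Finset.sum_smul, Complex.ofReal_sum]
      simp_rw [Complex.ofReal_mul]
    have P3 : ∑ i ∈ I, ((w i : ℝ) : ℂ) •
          ∑ σ : Fin 2, ((μ i σ : ℝ) : ℂ) • (nAt 0 hz σ - ((ν : ℝ) : ℂ) • (1 : FermionOp Λ')) =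
        ∑ σ : Fin 2, (((∑ i ∈ I, w i * μ i σ : ℝ)) : ℂ) •
          (nAt 0 hz σ - ((ν : ℝ) : ℂ) • (1 : FermionOp Λ')) := by
      simp_rw [Finset.smul_sum, smul_smul]
      rw [Finset.sum_comm]
      refine Finset.sum_congr rfl fun σ _ => ?_
      rw [← Finset.sum_smul, Complex.ofReal_sum]
      simp_rw [Complex.ofReal_mul]
    have P4 : ∑ i ∈ I, ((w i : ℝ) : ℂ) • (((κ : ℝ) : ℂ) •
          (((u i : ℝ) : ℂ) • (1 : FermionOp Λ') - fermionEmbed (PolySite.incl h0) (Ei i))) =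
        ((κ : ℝ) : ℂ) • ((((∑ i ∈ I, w i * u i : ℝ)) : ℂ) • (1 : FermionOp Λ') -
          fermionEmbed (PolySite.incl h0) (Φb.meanEnergyObs 1)) := by
      simp_rw [smul_comm ((w _ : ℝ) : ℂ) ((κ : ℝ) : ℂ)]
      rw [← Finset.smul_sum]
      congr 1
      simp_rw [smul_sub]
      rw [Finset.sum_sub_distrib]
      congr 1
      · simp_rw [smul_smul]
        rw [← Finset.sum_smul, Complex.ofReal_sum]
        simp_rw [Complex.ofReal_mul]
      · rw [hE', map_sum]
        exact Finset.sum_congr rfl fun i _ => by rw [map_smul]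
    have P5 : ∑ i ∈ I, ((w i : ℝ) : ℂ) • ∑ k ∈ A, ((lam i k : ℝ) : ℂ) • Ck k =
        ∑ k ∈ A, (((∑ i ∈ I, w i * lam i k : ℝ)) : ℂ) • Ck k := by
      simp_rw [Finset.smul_sum, smul_smul]
      rw [Finset.sum_comm]
      refine Finset.sum_congr rfl fun k _ => ?_
      rw [← Finset.sum_smul, Complex.ofReal_sum]
      simp_rw [Complex.ofReal_mul]
    have hdist : ∀ i ∈ I, ((w i : ℝ) : ℂ) • (Xw - ((c i : ℝ) : ℂ) • (1 : FermionOp Λ') -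
          ∑ σ : Fin 2, ((μ i σ : ℝ) : ℂ) • (nAt 0 hz σ - ((ν : ℝ) : ℂ) • (1 : FermionOp Λ')) -
          ((κ : ℝ) : ℂ) • (((u i : ℝ) : ℂ) • (1 : FermionOp Λ') - fermionEmbed (PolySite.incl h0) (Ei i)) -
          ∑ k ∈ A, ((lam i k : ℝ) : ℂ) • Ck k) =
        ((w i : ℝ) : ℂ) • Xw - ((w i : ℝ) : ℂ) • (((c i : ℝ) : ℂ) • (1 : FermionOp Λ')) -
          ((w i : ℝ) : ℂ) • ∑ σ : Fin 2, ((μ i σ : ℝ) : ℂ) • (nAt 0 hz σ - ((ν : ℝ) : ℂ) • (1 : FermionOp Λ')) -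
          ((w i : ℝ) : ℂ) • (((κ : ℝ) : ℂ) •
            (((u i : ℝ) : ℂ) • (1 : FermionOp Λ') - fermionEmbed (PolySite.incl h0) (Ei i))) -
          ((w i : ℝ) : ℂ) • ∑ k ∈ A, ((lam i k : ℝ) : ℂ) • Ck k := by
      intro i _
      rw [smul_sub, smul_sub, smul_sub, smul_sub]
    rw [Finset.sum_congr rfl hdist, Finset.sum_sub_distrib, Finset.sum_sub_distrib,
      Finset.sum_sub_distrib, Finset.sum_sub_distrib, P1, P2, P3, P4, P5]
  -- §B the right-hand sides combine
  have hr : ∑ i ∈ I, ((w i : ℝ) : ℂ) • (gramForm (Λm i) O +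
        (∑ k ∈ s, (Hi i * fermionEmbed (PolySite.incl hΛ) (B k) -
            fermionEmbed (PolySite.incl hΛ) (B k) * Hi i) +
          ∑ l ∈ tt, (fermionEmbed (PolySite.incl (hsh l))
              (fermionEmbed (PolySite.d4Emb (γ l) (wv l) Λ) (Y i l)) -
            fermionEmbed (PolySite.incl hΛ) (Y i l)) +
          ∑ j ∈ uu, b i j • ladderWord (cw j)) +
        (∑ m' ∈ ah, ((dc i m' : ℝ) : ℂ) • ((V m')ᴴ - V m') + ∑ k ∈ wd, a i k • ladderWord (word k))) =
      gramForm (∑ i ∈ I, ((w i : ℝ) : ℂ) • Λm i) O +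
        (∑ k ∈ s, (Φb.localHamiltonian Λ' * fermionEmbed (PolySite.incl hΛ) (B k) -
            fermionEmbed (PolySite.incl hΛ) (B k) * Φb.localHamiltonian Λ') +
          ∑ l ∈ tt, (fermionEmbed (PolySite.incl (hsh l))
              (fermionEmbed (PolySite.d4Emb (γ l) (wv l) Λ) (∑ i ∈ I, ((w i : ℝ) : ℂ) • Y i l)) -
            fermionEmbed (PolySite.incl hΛ) (∑ i ∈ I, ((w i : ℝ) : ℂ) • Y i l)) +
          ∑ j ∈ uu, (∑ i ∈ I, ((w i : ℝ) : ℂ) * b i j) • ladderWord (cw j)) +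
        (∑ m' ∈ ah, (((∑ i ∈ I, w i * dc i m' : ℝ)) : ℂ) • ((V m')ᴴ - V m') +
          ∑ k ∈ wd, (∑ i ∈ I, ((w i : ℝ) : ℂ) * a i k) • ladderWord (word k)) := by
    have Q1 : ∑ i ∈ I, ((w i : ℝ) : ℂ) • gramForm (Λm i) O =
        gramForm (∑ i ∈ I, ((w i : ℝ) : ℂ) • Λm i) O := (gramForm_sum_smul I _ Λm O).symm
    have Q2 : ∑ i ∈ I, ((w i : ℝ) : ℂ) • ∑ k ∈ s, (Hi i * fermionEmbed (PolySite.incl hΛ) (B k) -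
          fermionEmbed (PolySite.incl hΛ) (B k) * Hi i) =
        ∑ k ∈ s, (Φb.localHamiltonian Λ' * fermionEmbed (PolySite.incl hΛ) (B k) -
          fermionEmbed (PolySite.incl hΛ) (B k) * Φb.localHamiltonian Λ') := by
      simp_rw [Finset.smul_sum]
      rw [Finset.sum_comm]
      refine Finset.sum_congr rfl fun k _ => ?_
      have e1 : ∀ i, ((w i : ℝ) : ℂ) • (Hi i * fermionEmbed (PolySite.incl hΛ) (B k)) =
          (((w i : ℝ) : ℂ) • Hi i) * fermionEmbed (PolySite.incl hΛ) (B k) := fun i =>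
        (smul_mul_assoc _ _ _).symm
      have e2 : ∀ i, ((w i : ℝ) : ℂ) • (fermionEmbed (PolySite.incl hΛ) (B k) * Hi i) =
          fermionEmbed (PolySite.incl hΛ) (B k) * (((w i : ℝ) : ℂ) • Hi i) := fun i =>
        (mul_smul_comm _ _ _).symm
      simp_rw [smul_sub, e1, e2]
      rw [Finset.sum_sub_distrib, ← Finset.sum_mul, ← Finset.mul_sum, ← hH']
    have Q3 : ∑ i ∈ I, ((w i : ℝ) : ℂ) • ∑ l ∈ tt, (fermionEmbed (PolySite.incl (hsh l))
          (fermionEmbed (PolySite.d4Emb (γ l) (wv l) Λ) (Y i l)) - fermionEmbed (PolySite.incl hΛ) (Y i l)) =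
        ∑ l ∈ tt, (fermionEmbed (PolySite.incl (hsh l))
          (fermionEmbed (PolySite.d4Emb (γ l) (wv l) Λ) (∑ i ∈ I, ((w i : ℝ) : ℂ) • Y i l)) -
          fermionEmbed (PolySite.incl hΛ) (∑ i ∈ I, ((w i : ℝ) : ℂ) • Y i l)) := by
      simp_rw [Finset.smul_sum]
      rw [Finset.sum_comm]
      refine Finset.sum_congr rfl fun l _ => ?_
      simp_rw [smul_sub]
      rw [Finset.sum_sub_distrib, map_sum, map_sum, map_sum]
      congr 1
      · exact Finset.sum_congr rfl fun i _ => by rw [map_smul, map_smul]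
      · exact Finset.sum_congr rfl fun i _ => by rw [map_smul]
    have Q4 : ∑ i ∈ I, ((w i : ℝ) : ℂ) • ∑ j ∈ uu, b i j • ladderWord (cw j) =
        ∑ j ∈ uu, (∑ i ∈ I, ((w i : ℝ) : ℂ) * b i j) • ladderWord (cw j) := by
      simp_rw [Finset.smul_sum, smul_smul]
      rw [Finset.sum_comm]
      exact Finset.sum_congr rfl fun j _ => by rw [Finset.sum_smul]
    have Q5 : ∑ i ∈ I, ((w i : ℝ) : ℂ) • ∑ m' ∈ ah, ((dc i m' : ℝ) : ℂ) • ((V m')ᴴ - V m') =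
        ∑ m' ∈ ah, (((∑ i ∈ I, w i * dc i m' : ℝ)) : ℂ) • ((V m')ᴴ - V m') := by
      simp_rw [Finset.smul_sum, smul_smul]
      rw [Finset.sum_comm]
      refine Finset.sum_congr rfl fun m' _ => ?_
      rw [← Finset.sum_smul, Complex.ofReal_sum]
      simp_rw [Complex.ofReal_mul]
    have Q6 : ∑ i ∈ I, ((w i : ℝ) : ℂ) • ∑ k ∈ wd, a i k • ladderWord (word k) =
        ∑ k ∈ wd, (∑ i ∈ I, ((w i : ℝ) : ℂ) * a i k) • ladderWord (word k) := by
      simp_rw [Finset.smul_sum, smul_smul]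
      rw [Finset.sum_comm]
      exact Finset.sum_congr rfl fun k _ => by rw [Finset.sum_smul]
    simp only [smul_add, Finset.sum_add_distrib]
    rw [Q1, Q2, Q3, Q4, Q5, Q6]
  -- §C the combined identity, and the tree theorem at the barycentre
  have hs : ∑ i ∈ I, ((w i : ℝ) : ℂ) • (Xw - ((c i : ℝ) : ℂ) • (1 : FermionOp Λ') -
        ∑ σ : Fin 2, ((μ i σ : ℝ) : ℂ) • (nAt 0 hz σ - ((ν : ℝ) : ℂ) • (1 : FermionOp Λ')) -
        ((κ : ℝ) : ℂ) • (((u i : ℝ) : ℂ) • (1 : FermionOp Λ') - fermionEmbed (PolySite.incl h0) (Ei i)) -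
        ∑ k ∈ A, ((lam i k : ℝ) : ℂ) • Ck k) =
      ∑ i ∈ I, ((w i : ℝ) : ℂ) • (gramForm (Λm i) O +
        (∑ k ∈ s, (Hi i * fermionEmbed (PolySite.incl hΛ) (B k) -
            fermionEmbed (PolySite.incl hΛ) (B k) * Hi i) +
          ∑ l ∈ tt, (fermionEmbed (PolySite.incl (hsh l))
              (fermionEmbed (PolySite.d4Emb (γ l) (wv l) Λ) (Y i l)) -
            fermionEmbed (PolySite.incl hΛ) (Y i l)) +
          ∑ j ∈ uu, b i j • ladderWord (cw j)) +
        (∑ m' ∈ ah, ((dc i m' : ℝ) : ℂ) • ((V m')ᴴ - V m') + ∑ k ∈ wd, a i k • ladderWord (word k))) :=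
    Finset.sum_congr rfl fun i hi => by rw [hcert i hi]
  rw [hl, hr] at hs
  -- the averaged cut multipliers are nonnegative
  have hlam' : ∀ k ∈ A, 0 ≤ ∑ i ∈ I, w i * lam i k := fun k hk =>
    Finset.sum_nonneg fun i hi => mul_nonneg (hw0 i hi) (hlam i hi k hk)
  have h := hω.re_sum_expect_d4_ge_of_window_certificate_TT'_ineq_crossCuts t (∑ i ∈ I, w i * tp i)
    hUbar hn0 hn2 hκ hu A tpc Uc lo (fun k => ∑ i ∈ I, w i * lam i k) hUc hlo hlam' hΛ h8 h0 hz h1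
    hmul Xw (fun σ => ∑ i ∈ I, w i * μ i σ) ν hΛbar O s B tt γ hγS wv hsh
    (fun l => ∑ i ∈ I, ((w i : ℝ) : ℂ) • Y i l) uu (fun j => ∑ i ∈ I, ((w i : ℝ) : ℂ) * b i j) cw hcw
    ah (fun m' => ∑ i ∈ I, w i * dc i m') V wd (fun k => ∑ i ∈ I, ((w i : ℝ) : ℂ) * a i k) word hs
    hLs hψ hψ1
  simpa using h

/-! ### §3 The box evaluator's calling conventions (translation-only, prescribed target) -/

/-- **Weighted-corner box certificate with anchor cuts at a prescribed target `(t', U')`**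
(translation-only form; the engine supplies the target and the barycentre identities
`Σ wᵢ t'ᵢ = t'`, `Σ wᵢ Uᵢ = U'`; the caps `uᵢ` are the corner values of ONE affine majorant of the
energy density, so that `e(t,t',U',n) ≤ Σ wᵢ uᵢ`): for every torus-limit sector ground state `ω` at
`(t', U')`, `Σ wᵢ (cᵢ − Σₖ ‖aᵢₖ‖ + (Σ_σ μᵢσ)(n/2 − ν)) ≤ Re ω_{Λ'}(X)` (`‖Σ wᵢ aᵢₖ‖ ≤ Σ wᵢ ‖aᵢₖ‖`).
[cite: WangEtAl2024, §III] -/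
theorem IsTorusLimitOf.re_expect_ge_of_window_certificates_convexComb_TT'_ineq_crossCuts_weighted_at
    (t t' U' : ℝ) {ι₀ : Type*} (I : Finset ι₀) (w : ι₀ → ℝ) (hw0 : ∀ i ∈ I, 0 ≤ w i)
    (hw1 : ∑ i ∈ I, w i = 1) (tp U u c : ι₀ → ℝ) (hU : ∀ i ∈ I, 0 ≤ U i)
    (htp : ∑ i ∈ I, w i * tp i = t') (hUU : ∑ i ∈ I, w i * U i = U')
    {n : ℝ} (hn0 : 0 ≤ n) (hn2 : n < 2) {κ : ℝ} (hκ : 0 ≤ κ)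
    (hu : ThermodynamicLimit.energyDensityTT' t t' U' n ≤ ∑ i ∈ I, w i * u i)
    {α : Type*} (A : Finset α) (tpc Uc lo : α → ℝ) (lam : ι₀ → α → ℝ) (hUc : ∀ k ∈ A, 0 ≤ Uc k)
    (hlo : ∀ k ∈ A, lo k ≤ ThermodynamicLimit.energyDensityTT' t (tpc k) (Uc k) n)
    (hlam : ∀ i ∈ I, ∀ k ∈ A, 0 ≤ lam i k)
    {Λ Λ' : Finset (Site 2)} (hΛ : Λ ⊆ Λ') (h8 : thicken Λ 1 ⊆ Λ')
    (h0 : thicken ({0} : Finset (Site 2)) 1 ⊆ Λ') (hz : (0 : Site 2) ∈ Λ')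
    (Xw : FermionOp Λ') (μ : ι₀ → Fin 2 → ℝ) (ν : ℝ)
    {m : Type*} [Fintype m] [DecidableEq m] (Λm : ι₀ → Matrix m m ℂ)
    (hΛm : ∀ i ∈ I, (Λm i).PosSemidef) (O : m → FermionOp Λ')
    {κ' : Type*} (s : Finset κ') (B : κ' → FermionOp Λ)
    {ι : Type*} (tt : Finset ι) (γ : ι → DihedralGroup 4) (hγ1 : ∀ l ∈ tt, γ l = 1) (wv : ι → Site 2)
    (hsh : ∀ l, d4ShiftSet (γ l) (wv l) Λ ⊆ Λ') (Y : ι₀ → ι → FermionOp Λ)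
    {ρ : Type*} (uu : Finset ρ) (b : ι₀ → ρ → ℂ) (cw : ρ → List (Orb (PolySite Λ') × Bool))
    (hcw : ∀ j ∈ uu, ladderCharge (cw j) ≠ 0 ∨ ladderSpinCharge (cw j) ≠ 0)
    {δ : Type*} (ah : Finset δ) (dc : ι₀ → δ → ℝ) (V : δ → FermionOp Λ')
    {κ'' : Type*} (wd : Finset κ'') (a : ι₀ → κ'' → ℂ)
    (word : κ'' → List (Orb (PolySite Λ') × Bool))
    (hcert : ∀ i ∈ I, Xw - ((c i : ℝ) : ℂ) • (1 : FermionOp Λ') -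
        ∑ σ : Fin 2, ((μ i σ : ℝ) : ℂ) • (nAt 0 hz σ - ((ν : ℝ) : ℂ) • (1 : FermionOp Λ')) -
        ((κ : ℝ) : ℂ) • (((u i : ℝ) : ℂ) • (1 : FermionOp Λ') -
          fermionEmbed (PolySite.incl h0)
            ((hubbardTTPrimeFermionInteraction t (tp i) (U i)).meanEnergyObs 1)) -
        ∑ k ∈ A, ((lam i k : ℝ) : ℂ) •
          (fermionEmbed (PolySite.incl h0)
              ((hubbardTTPrimeFermionInteraction t (tpc k) (Uc k)).meanEnergyObs 1) -
            ((lo k : ℝ) : ℂ) • (1 : FermionOp Λ')) =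
      gramForm (Λm i) O +
        (∑ k ∈ s, ((hubbardTTPrimeFermionInteraction t (tp i) (U i)).localHamiltonian Λ' *
              fermionEmbed (PolySite.incl hΛ) (B k) -
            fermionEmbed (PolySite.incl hΛ) (B k) *
              (hubbardTTPrimeFermionInteraction t (tp i) (U i)).localHamiltonian Λ') +
          ∑ l ∈ tt, (fermionEmbed (PolySite.incl (hsh l))
              (fermionEmbed (PolySite.d4Emb (γ l) (wv l) Λ) (Y i l)) -
            fermionEmbed (PolySite.incl hΛ) (Y i l)) +
          ∑ j ∈ uu, b i j • ladderWord (cw j)) +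
        (∑ m' ∈ ah, ((dc i m' : ℝ) : ℂ) • ((V m')ᴴ - V m') + ∑ k ∈ wd, a i k • ladderWord (word k)))
    {Ls : ℕ → ℕ} (hLs : Tendsto Ls atTop atTop)
    {ψ : ∀ L, Fock (Orb (FermionTorus 2 L))}
    (hψ : ∀ j, IsGroundStateInSector (hubbardTorusTT' (Ls j) t t' U')
      (ThermodynamicLimit.rectN n (Ls j)) 0 (ψ (Ls j)))
    (hψ1 : ∀ j, star (ψ (Ls j)) ⬝ᵥ ψ (Ls j) = 1)
    {ω : InfVolFermionState 2} (hω : ω.IsTorusLimitOf ψ Ls) :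
    ∑ i ∈ I, w i * (c i - ∑ k ∈ wd, ‖a i k‖ + (∑ σ : Fin 2, μ i σ) * (n / 2 - ν)) ≤
      (ω.expect Λ' Xw).re := by
  subst htp hUU
  have h1 : (1 : DihedralGroup 4) ∈ ({1} : Finset (DihedralGroup 4)) := Finset.mem_singleton_self 1
  have hmul : ∀ a ∈ ({1} : Finset (DihedralGroup 4)), ∀ b ∈ ({1} : Finset (DihedralGroup 4)),
      a * b ∈ ({1} : Finset (DihedralGroup 4)) := by
    intro a ha b hb
    rw [Finset.mem_singleton] at ha hb ⊢
    rw [ha, hb, mul_one]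
  have hγS : ∀ l ∈ tt, γ l ∈ ({1} : Finset (DihedralGroup 4)) := fun l hl =>
    Finset.mem_singleton.2 (hγ1 l hl)
  have h := hω.re_sum_expect_d4_ge_of_window_certificates_convexComb_TT'_ineq_crossCuts t I w hw0 hw1
    tp U u c hU hn0 hn2 hκ hu A tpc Uc lo lam hUc hlo hlam hΛ h8 h0 hz h1 hmul Xw μ ν Λm hΛm O s B tt
    γ hγS wv hsh Y uu b cw hcw ah dc V wd a word hcert hLs hψ hψ1
  rw [Finset.sum_singleton, Finset.card_singleton, Nat.cast_one, inv_one, one_mul,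
    ω.expect_fermionEmbed_d4Emb_one_zero] at h
  -- `‖Σ w a‖ ≤ Σ w ‖a‖`
  have htri : ∑ k ∈ wd, ‖∑ i ∈ I, ((w i : ℝ) : ℂ) * a i k‖ ≤
      ∑ k ∈ wd, ∑ i ∈ I, w i * ‖a i k‖ := by
    refine Finset.sum_le_sum fun k _ => (norm_sum_le _ _).trans (Finset.sum_le_sum fun i hi => ?_)
    rw [norm_mul, Complex.norm_real, Real.norm_of_nonneg (hw0 i hi)]
  -- rearrange the weighted corner bounds
  have hre : ∑ i ∈ I, w i * (c i - ∑ k ∈ wd, ‖a i k‖ + (∑ σ : Fin 2, μ i σ) * (n / 2 - ν)) =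
      ∑ i ∈ I, w i * c i - ∑ k ∈ wd, ∑ i ∈ I, w i * ‖a i k‖ +
        (∑ σ : Fin 2, ∑ i ∈ I, w i * μ i σ) * (n / 2 - ν) := by
    have e1 : ∀ i, w i * (c i - ∑ k ∈ wd, ‖a i k‖ + (∑ σ : Fin 2, μ i σ) * (n / 2 - ν)) =
        w i * c i - ∑ k ∈ wd, w i * ‖a i k‖ + ∑ σ : Fin 2, w i * μ i σ * (n / 2 - ν) := by
      intro i
      rw [mul_add, mul_sub, Finset.mul_sum, Finset.sum_mul, Finset.mul_sum]
      simp_rw [mul_assoc]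
    simp_rw [e1]
    rw [Finset.sum_add_distrib, Finset.sum_sub_distrib, Finset.sum_comm (s := I) (t := wd)]
    congr 1
    rw [Finset.sum_mul, Finset.sum_comm]
    exact Finset.sum_congr rfl fun σ _ => by rw [Finset.sum_mul]
  rw [hre]
  linarith

/-- **Re-booked weighted-corner box certificate with anchor cuts** (per-vertex cap VALUES `uᵢ`,
each corner solved under its own certified cap; the barycentre hypothesis is `e(t,t',U',n) ≤ ū` for
ANY certified `ū` and the conclusion pays the cap re-booking `κ·(Σ wᵢuᵢ − ū)`):
`Σ wᵢ (cᵢ − Σₖ ‖aᵢₖ‖ + (Σ_σ μᵢσ)(n/2 − ν)) + κ(Σ wᵢ uᵢ − ū) ≤ Re ω_{Λ'}(X)`.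
(In the corner identity the constants `(cᵢ, uᵢ)` enter only through `cᵢ + κuᵢ`; apply
`…_crossCuts_weighted_at` with `(cᵢ + κ(uᵢ − ū), ū)` — the argument of
`…convexComb_TT'_ineq_weighted_at_rebook`, cut rows untouched.) [cite: WangEtAl2024, §III]
[cite: Bertsekas1999NonlinearProgramming, Prop. 5.1.3] -/
theorem IsTorusLimitOf.re_expect_ge_of_window_certificates_convexComb_TT'_ineq_crossCuts_weighted_at_rebook
    (t t' U' : ℝ) {ι₀ : Type*} (I : Finset ι₀) (w : ι₀ → ℝ) (hw0 : ∀ i ∈ I, 0 ≤ w i)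
    (hw1 : ∑ i ∈ I, w i = 1) (tp U u c : ι₀ → ℝ) (hU : ∀ i ∈ I, 0 ≤ U i)
    (htp : ∑ i ∈ I, w i * tp i = t') (hUU : ∑ i ∈ I, w i * U i = U')
    {n : ℝ} (hn0 : 0 ≤ n) (hn2 : n < 2) {κ : ℝ} (hκ : 0 ≤ κ) {ū : ℝ}
    (hu : ThermodynamicLimit.energyDensityTT' t t' U' n ≤ ū)
    {α : Type*} (A : Finset α) (tpc Uc lo : α → ℝ) (lam : ι₀ → α → ℝ) (hUc : ∀ k ∈ A, 0 ≤ Uc k)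
    (hlo : ∀ k ∈ A, lo k ≤ ThermodynamicLimit.energyDensityTT' t (tpc k) (Uc k) n)
    (hlam : ∀ i ∈ I, ∀ k ∈ A, 0 ≤ lam i k)
    {Λ Λ' : Finset (Site 2)} (hΛ : Λ ⊆ Λ') (h8 : thicken Λ 1 ⊆ Λ')
    (h0 : thicken ({0} : Finset (Site 2)) 1 ⊆ Λ') (hz : (0 : Site 2) ∈ Λ')
    (Xw : FermionOp Λ') (μ : ι₀ → Fin 2 → ℝ) (ν : ℝ)
    {m : Type*} [Fintype m] [DecidableEq m] (Λm : ι₀ → Matrix m m ℂ)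
    (hΛm : ∀ i ∈ I, (Λm i).PosSemidef) (O : m → FermionOp Λ')
    {κ' : Type*} (s : Finset κ') (B : κ' → FermionOp Λ)
    {ι : Type*} (tt : Finset ι) (γ : ι → DihedralGroup 4) (hγ1 : ∀ l ∈ tt, γ l = 1) (wv : ι → Site 2)
    (hsh : ∀ l, d4ShiftSet (γ l) (wv l) Λ ⊆ Λ') (Y : ι₀ → ι → FermionOp Λ)
    {ρ : Type*} (uu : Finset ρ) (b : ι₀ → ρ → ℂ) (cw : ρ → List (Orb (PolySite Λ') × Bool))
    (hcw : ∀ j ∈ uu, ladderCharge (cw j) ≠ 0 ∨ ladderSpinCharge (cw j) ≠ 0)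
    {δ : Type*} (ah : Finset δ) (dc : ι₀ → δ → ℝ) (V : δ → FermionOp Λ')
    {κ'' : Type*} (wd : Finset κ'') (a : ι₀ → κ'' → ℂ)
    (word : κ'' → List (Orb (PolySite Λ') × Bool))
    (hcert : ∀ i ∈ I, Xw - ((c i : ℝ) : ℂ) • (1 : FermionOp Λ') -
        ∑ σ : Fin 2, ((μ i σ : ℝ) : ℂ) • (nAt 0 hz σ - ((ν : ℝ) : ℂ) • (1 : FermionOp Λ')) -
        ((κ : ℝ) : ℂ) • (((u i : ℝ) : ℂ) • (1 : FermionOp Λ') -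
          fermionEmbed (PolySite.incl h0)
            ((hubbardTTPrimeFermionInteraction t (tp i) (U i)).meanEnergyObs 1)) -
        ∑ k ∈ A, ((lam i k : ℝ) : ℂ) •
          (fermionEmbed (PolySite.incl h0)
              ((hubbardTTPrimeFermionInteraction t (tpc k) (Uc k)).meanEnergyObs 1) -
            ((lo k : ℝ) : ℂ) • (1 : FermionOp Λ')) =
      gramForm (Λm i) O +
        (∑ k ∈ s, ((hubbardTTPrimeFermionInteraction t (tp i) (U i)).localHamiltonian Λ' *
              fermionEmbed (PolySite.incl hΛ) (B k) -
            fermionEmbed (PolySite.incl hΛ) (B k) *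
              (hubbardTTPrimeFermionInteraction t (tp i) (U i)).localHamiltonian Λ') +
          ∑ l ∈ tt, (fermionEmbed (PolySite.incl (hsh l))
              (fermionEmbed (PolySite.d4Emb (γ l) (wv l) Λ) (Y i l)) -
            fermionEmbed (PolySite.incl hΛ) (Y i l)) +
          ∑ j ∈ uu, b i j • ladderWord (cw j)) +
        (∑ m' ∈ ah, ((dc i m' : ℝ) : ℂ) • ((V m')ᴴ - V m') + ∑ k ∈ wd, a i k • ladderWord (word k)))
    {Ls : ℕ → ℕ} (hLs : Tendsto Ls atTop atTop)
    {ψ : ∀ L, Fock (Orb (FermionTorus 2 L))}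
    (hψ : ∀ j, IsGroundStateInSector (hubbardTorusTT' (Ls j) t t' U')
      (ThermodynamicLimit.rectN n (Ls j)) 0 (ψ (Ls j)))
    (hψ1 : ∀ j, star (ψ (Ls j)) ⬝ᵥ ψ (Ls j) = 1)
    {ω : InfVolFermionState 2} (hω : ω.IsTorusLimitOf ψ Ls) :
    ∑ i ∈ I, w i * (c i - ∑ k ∈ wd, ‖a i k‖ + (∑ σ : Fin 2, μ i σ) * (n / 2 - ν)) +
        κ * (∑ i ∈ I, w i * u i - ū) ≤ (ω.expect Λ' Xw).re := by
  -- re-booked constants: `c' i = c i + κ (u i - ū)`, cap value `ū` at every corner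
  have hu' : ThermodynamicLimit.energyDensityTT' t t' U' n ≤ ∑ i ∈ I, w i * ū := by
    rw [← Finset.sum_mul, hw1, one_mul]; exact hu
  have hcert' : ∀ i ∈ I, Xw - ((c i + κ * (u i - ū) : ℝ) : ℂ) • (1 : FermionOp Λ') -
        ∑ σ : Fin 2, ((μ i σ : ℝ) : ℂ) • (nAt 0 hz σ - ((ν : ℝ) : ℂ) • (1 : FermionOp Λ')) -
        ((κ : ℝ) : ℂ) • (((ū : ℝ) : ℂ) • (1 : FermionOp Λ') -
          fermionEmbed (PolySite.incl h0)
            ((hubbardTTPrimeFermionInteraction t (tp i) (U i)).meanEnergyObs 1)) -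
        ∑ k ∈ A, ((lam i k : ℝ) : ℂ) •
          (fermionEmbed (PolySite.incl h0)
              ((hubbardTTPrimeFermionInteraction t (tpc k) (Uc k)).meanEnergyObs 1) -
            ((lo k : ℝ) : ℂ) • (1 : FermionOp Λ')) =
      gramForm (Λm i) O +
        (∑ k ∈ s, ((hubbardTTPrimeFermionInteraction t (tp i) (U i)).localHamiltonian Λ' *
              fermionEmbed (PolySite.incl hΛ) (B k) -
            fermionEmbed (PolySite.incl hΛ) (B k) *
              (hubbardTTPrimeFermionInteraction t (tp i) (U i)).localHamiltonian Λ') +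
          ∑ l ∈ tt, (fermionEmbed (PolySite.incl (hsh l))
              (fermionEmbed (PolySite.d4Emb (γ l) (wv l) Λ) (Y i l)) -
            fermionEmbed (PolySite.incl hΛ) (Y i l)) +
          ∑ j ∈ uu, b i j • ladderWord (cw j)) +
        (∑ m' ∈ ah, ((dc i m' : ℝ) : ℂ) • ((V m')ᴴ - V m') + ∑ k ∈ wd, a i k • ladderWord (word k)) := by
    intro i hi
    rw [← hcert i hi]
    have hc : ((c i + κ * (u i - ū) : ℝ) : ℂ) =
        ((c i : ℝ) : ℂ) + ((κ : ℝ) : ℂ) * (((u i : ℝ) : ℂ) - ((ū : ℝ) : ℂ)) := by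
      push_cast; ring
    rw [hc, add_smul, mul_smul, smul_sub, smul_sub, sub_smul, smul_sub]
    abel
  have h := hω.re_expect_ge_of_window_certificates_convexComb_TT'_ineq_crossCuts_weighted_at t t' U' I
    w hw0 hw1 tp U (fun _ => ū) (fun i => c i + κ * (u i - ū)) hU htp hUU hn0 hn2 hκ hu' A tpc Uc lo
    lam hUc hlo hlam hΛ h8 h0 hz Xw μ ν Λm hΛm O s B tt γ hγ1 wv hsh Y uu b cw hcw ah dc V wd a word
    hcert' hLs hψ hψ1
  have e : ∑ i ∈ I, w i * (c i + κ * (u i - ū) - ∑ k ∈ wd, ‖a i k‖ + (∑ σ : Fin 2, μ i σ) * (n / 2 - ν)) =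
      ∑ i ∈ I, w i * (c i - ∑ k ∈ wd, ‖a i k‖ + (∑ σ : Fin 2, μ i σ) * (n / 2 - ν)) +
        κ * (∑ i ∈ I, w i * u i - ū) := by
    have : κ * (∑ i ∈ I, w i * u i - ū) = ∑ i ∈ I, w i * (κ * (u i - ū)) := by
      rw [show ū = ∑ i ∈ I, w i * ū by rw [← Finset.sum_mul, hw1, one_mul], ← Finset.sum_sub_distrib,
        Finset.mul_sum]
      refine Finset.sum_congr rfl fun i _ => ?_
      rw [← Finset.sum_mul, hw1, one_mul]; ring
    rw [this, ← Finset.sum_add_distrib]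
    exact Finset.sum_congr rfl fun i _ => by ring
  rw [← e]
  exact h

end InfVolFermionState

end Literature.MathematicalPhysics.QuantumLattice

end
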